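import Summits.Ventures.PercRepro.ProfilePointedPGirth

/-!
# PercRepro — A MINIMAL (Ĉ)-WITNESS HAS A DEPENDENT SET THROUGH `p` WITH BETWEEN `4` AND `N/2` ELEMENTS (p10, gen 25)

Combining `MinimalWitness.three_le_failing_level` (ProfilePointedGirth: the failing level of a minimal witness is at least
`3`, through gen 24's «every 3-subset of a minimal witness is independent») with
`exists_dependent_mem_of_not_pointedRow_level_of_fact` (ProfilePointedPGirth: a failure at level `k` needs a dependent
`(k+1)`-set through `p`): **a minimal witness has a dependent set `X ∋ p` with `4 ≤ #X ≤ N/2`** — `p` lies in a circuit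
with at least `4` and at most `N/2` elements — modulo Theorem A.  Nothing here asserts (Ĉ).
-/

open scoped Matroid

namespace PercRepro.Cogirth

open Finset ThmH Skew

variable {α : Type} [DecidableEq α] {M : Matroid α} [M.Finite]

/-- **A minimal (Ĉ)-witness has a dependent set through `p` with between `4` and `N/2` elements** (mod Theorem A). -/
theorem MinimalWitness.exists_dependent_mem_four_le (hfact : BiIndepDensityLogConcave α) {p : α}
    (h : MinimalWitness M p) :
    ∃ X ⊆ gr M, p ∈ X ∧ 4 ≤ X.card ∧ 2 * X.card ≤ (gr M).card ∧ rk M X < X.card := by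
  obtain ⟨k, hk3, hk, hfail⟩ := h.three_le_failing_level hfact
  obtain ⟨X, hX, hpX, hXc, hXr⟩ := exists_dependent_mem_of_not_pointedRow_level_of_fact hfact h.1 hk hfail
  exact ⟨X, hX, hpX, by omega, by omega, by omega⟩

end PercRepro.Cogirth
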